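import Mathlib
import Summits.Ventures.PercRepro2.CoinKSureLayer
import Summits.Ventures.PercRepro2.CoinKSureAD
import Summits.Ventures.PercRepro2.CoinKSureFibers

/-!
# The OR-tail gate functional with MIXED centres — the gate centred at the `x`-mean of one
`R`-law and the `y`-mean of another (blind cell PercRepro2, night-2 g22; proofs/NIGHT2-DARC.md §62)

The clean-state theorem `gate_functional_nonneg` (§49) bounds `∑ G' (Λx − Λ₁)(Λy − Λ₂)` where
both centres `Λ₁/Λ`, `Λ₂/Λ` are the means of ONE `R`-law `G`.  Its proof — within-state FKG of
the gate, the layer cake of the `y`-state-means whose level sets are entered cluster-up-sets on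
which the gate is Holley-above the `R`-law, the ideal state below the `R`-means — never uses that
the two centres come from the same law.  `gate_functional_nonneg_mixed` is the same theorem with
TWO `R`-laws `Gx`, `Gy` (both log-supermodular, both equal to the gate off the entries, the gate
Holley-above each from every entered cluster): `∑ G' (Λˣ x − Λˣ₁)(Λʸ y − Λʸ₂) ≥ 0`.

For the AND-switch chain (§56) this gives `chain_world1_mixed_nonneg`: the WORLD-1 gate
`ν · chainMix ent ent' 1 c d'` centred at the `x`-mean of the chain `R`-law at ANY coin
probability `ρ₁` and the `y`-mean of the chain `R`-law at ANY `ρ₂` has nonnegative cleared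
functional — the two mixed-centre terms `U(1,0,1)`, `U(0,1,1)` of the Bernstein form of the
chain's cubic `T(ρ)` (§62), which the census saw `≥ 0` in every check.
-/

namespace Summit.Ventures.PercRepro2.Coin

open Classical

section MixedAbstract

variable {V : Type*} [DecidableEq V] {R : Type*} [Field R] [LinearOrder R] [IsStrictOrderedRing R]

/-- **THE GATE FUNCTIONAL WITH MIXED CENTRES IS NONNEGATIVE.** `Gx`, `Gy` (two `R`-laws) and
`G'` (the gate) log-supermodular on `U.powerset`, the gate Holley-above each `R`-law from every
cluster containing an entry of `ent` (`wMLx`, `wMLy`), equal to both on the entry-free clusters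
(`hIx`, `hIy`); `x, y` nonnegative increasing markers.  Then, with `Λˣ = ∑ Gx`, `Λˣ₁ = ∑ Gx x`,
`Λʸ = ∑ Gy`, `Λʸ₂ = ∑ Gy y`: `∑ G' (Λˣ x − Λˣ₁)(Λʸ y − Λʸ₂) ≥ 0` in cleared form. -/
theorem gate_functional_nonneg_mixed (U ent : Finset V) (Gx Gy G' x y : Finset V → R)
    (hGx : ∀ W, 0 ≤ Gx W) (hGy : ∀ W, 0 ≤ Gy W) (hG' : ∀ W, 0 ≤ G' W)
    (hx0 : ∀ W, 0 ≤ x W) (hy0 : ∀ W, 0 ≤ y W)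
    (hxm : ∀ s t, x s ≤ x (s ∪ t)) (hym : ∀ s t, y s ≤ y (s ∪ t))
    (wLLx : ∀ s ⊆ U, ∀ t ⊆ U, Gx s * Gx t ≤ Gx (s ∩ t) * Gx (s ∪ t))
    (wLLy : ∀ s ⊆ U, ∀ t ⊆ U, Gy s * Gy t ≤ Gy (s ∩ t) * Gy (s ∪ t))
    (wMM : ∀ s ⊆ U, ∀ t ⊆ U, G' s * G' t ≤ G' (s ∩ t) * G' (s ∪ t))
    (wMLx : ∀ s ⊆ U, ∀ t ⊆ U, (∃ r ∈ ent, r ∈ s) → G' s * Gx t ≤ Gx (s ∩ t) * G' (s ∪ t))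
    (wMLy : ∀ s ⊆ U, ∀ t ⊆ U, (∃ r ∈ ent, r ∈ s) → G' s * Gy t ≤ Gy (s ∩ t) * G' (s ∪ t))
    (hIx : ∀ W, W ∩ ent = ∅ → G' W = Gx W) (hIy : ∀ W, W ∩ ent = ∅ → G' W = Gy W) :
    0 ≤ (∑ W ∈ U.powerset, Gx W) * (∑ W ∈ U.powerset, Gy W) *
          (∑ W ∈ U.powerset, G' W * (x W * y W))
        - (∑ W ∈ U.powerset, Gx W) * (∑ W ∈ U.powerset, Gy W * y W) *
          (∑ W ∈ U.powerset, G' W * x W)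
        - (∑ W ∈ U.powerset, Gy W) * (∑ W ∈ U.powerset, Gx W * x W) *
          (∑ W ∈ U.powerset, G' W * y W)
        + (∑ W ∈ U.powerset, Gx W * x W) * (∑ W ∈ U.powerset, Gy W * y W) *
          (∑ W ∈ U.powerset, G' W) := by
  -- the two `R`-law totals
  set Λx := ∑ W ∈ U.powerset, Gx W with hΛx
  set Λx₁ := ∑ W ∈ U.powerset, Gx W * x W with hΛx₁
  set Λy := ∑ W ∈ U.powerset, Gy W with hΛy
  set Λy₂ := ∑ W ∈ U.powerset, Gy W * y W with hΛy₂
  have hΛx0 : 0 ≤ Λx := Finset.sum_nonneg fun W _ => hGx W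
  have hΛy0 : 0 ≤ Λy := Finset.sum_nonneg fun W _ => hGy W
  clear_value Λx Λx₁ Λy Λy₂
  -- state masses and state means of the gate
  set N : Finset V → R := fun e => ∑ W ∈ U.powerset.filter (fun W => W ∩ ent = e), G' W with hN
  set Nx : Finset V → R :=
    fun e => ∑ W ∈ U.powerset.filter (fun W => W ∩ ent = e), G' W * x W with hNx
  set Ny : Finset V → R :=
    fun e => ∑ W ∈ U.powerset.filter (fun W => W ∩ ent = e), G' W * y W with hNy
  have hN0 : ∀ e, 0 ≤ N e := fun e => Finset.sum_nonneg fun W _ => hG' W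
  have hNx0 : ∀ e, 0 ≤ Nx e := fun e => Finset.sum_nonneg fun W _ => mul_nonneg (hG' W) (hx0 W)
  have hNy0 : ∀ e, 0 ≤ Ny e := fun e => Finset.sum_nonneg fun W _ => mul_nonneg (hG' W) (hy0 W)
  set Xb : Finset V → R := fun W => Nx (W ∩ ent) / N (W ∩ ent) with hXb
  set Yb : Finset V → R := fun W => Ny (W ∩ ent) / N (W ∩ ent) with hYb
  have hXb0 : ∀ W, 0 ≤ Xb W := fun W => div_nonneg (hNx0 _) (hN0 _)
  have hYb0 : ∀ W, 0 ≤ Yb W := fun W => div_nonneg (hNy0 _) (hN0 _)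
  -- the state mass of a cluster in the support is positive
  have hNpos : ∀ s ⊆ U, G' s ≠ 0 → 0 < N (s ∩ ent) := by
    intro s hs hs0
    have h1 : 0 < G' s := lt_of_le_of_ne (hG' s) (Ne.symm hs0)
    have h2 : G' s ≤ N (s ∩ ent) :=
      Finset.single_le_sum (f := G') (fun W _ => hG' W)
        (Finset.mem_filter.mpr ⟨Finset.mem_powerset.mpr hs, rfl⟩)
    exact lt_of_lt_of_le h1 h2
  -- joins stay in the support
  have hjoin : ∀ s ⊆ U, ∀ t ⊆ U, G' s ≠ 0 → G' t ≠ 0 → G' (s ∪ t) ≠ 0 := by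
    intro s hs t ht hs0 ht0 hu
    have h1 : 0 < G' s * G' t :=
      mul_pos (lt_of_le_of_ne (hG' s) (Ne.symm hs0)) (lt_of_le_of_ne (hG' t) (Ne.symm ht0))
    have h2 := wMM s hs t ht
    rw [hu, mul_zero] at h2
    exact absurd (lt_of_lt_of_le h1 h2) (lt_irrefl 0)
  have hjoinx : ∀ s ⊆ U, ∀ t ⊆ U, (∃ r ∈ ent, r ∈ s) → G' s ≠ 0 → Gx t ≠ 0 →
      G' (s ∪ t) ≠ 0 := by
    intro s hs t ht hent hs0 ht0 hu
    have h1 : 0 < G' s * Gx t :=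
      mul_pos (lt_of_le_of_ne (hG' s) (Ne.symm hs0)) (lt_of_le_of_ne (hGx t) (Ne.symm ht0))
    have h2 := wMLx s hs t ht hent
    rw [hu, mul_zero] at h2
    exact absurd (lt_of_lt_of_le h1 h2) (lt_irrefl 0)
  have hjoiny : ∀ s ⊆ U, ∀ t ⊆ U, (∃ r ∈ ent, r ∈ s) → G' s ≠ 0 → Gy t ≠ 0 →
      G' (s ∪ t) ≠ 0 := by
    intro s hs t ht hent hs0 ht0 hu
    have h1 : 0 < G' s * Gy t :=
      mul_pos (lt_of_le_of_ne (hG' s) (Ne.symm hs0)) (lt_of_le_of_ne (hGy t) (Ne.symm ht0))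
    have h2 := wMLy s hs t ht hent
    rw [hu, mul_zero] at h2
    exact absurd (lt_of_lt_of_le h1 h2) (lt_irrefl 0)
  -- the state means are increasing on the support
  have hXb_mono : ∀ s ⊆ U, ∀ t ⊆ U, G' s ≠ 0 → G' (s ∪ t) ≠ 0 → Xb s ≤ Xb (s ∪ t) := by
    intro s hs t ht hs0 hu0
    have hee : s ∩ ent ⊆ (s ∪ t) ∩ ent :=
      Finset.inter_subset_inter Finset.subset_union_left (Finset.Subset.refl _)
    have hNs := hNpos s hs hs0
    have hNu := hNpos (s ∪ t) (Finset.union_subset hs ht) hu0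
    have key : Nx (s ∩ ent) * N ((s ∪ t) ∩ ent) ≤ N (s ∩ ent) * Nx ((s ∪ t) ∩ ent) :=
      fiber_holley U ent (s ∩ ent) ((s ∪ t) ∩ ent) G' x hG' hx0 hxm wMM hee
    show Nx (s ∩ ent) / N (s ∩ ent) ≤ Nx ((s ∪ t) ∩ ent) / N ((s ∪ t) ∩ ent)
    rw [div_le_div_iff₀ hNs hNu]
    linarith [key]
  have hYb_mono : ∀ s ⊆ U, ∀ t ⊆ U, G' s ≠ 0 → G' (s ∪ t) ≠ 0 → Yb s ≤ Yb (s ∪ t) := by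
    intro s hs t ht hs0 hu0
    have hee : s ∩ ent ⊆ (s ∪ t) ∩ ent :=
      Finset.inter_subset_inter Finset.subset_union_left (Finset.Subset.refl _)
    have hNs := hNpos s hs hs0
    have hNu := hNpos (s ∪ t) (Finset.union_subset hs ht) hu0
    have key : Ny (s ∩ ent) * N ((s ∪ t) ∩ ent) ≤ N (s ∩ ent) * Ny ((s ∪ t) ∩ ent) :=
      fiber_holley U ent (s ∩ ent) ((s ∪ t) ∩ ent) G' y hG' hy0 hym wMM hee
    show Ny (s ∩ ent) / N (s ∩ ent) ≤ Ny ((s ∪ t) ∩ ent) / N ((s ∪ t) ∩ ent)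
    rw [div_le_div_iff₀ hNs hNu]
    linarith [key]
  -- the ideal state: gate = both `R`-laws there, and its means are below their global means
  have hG'Ix : ∀ W ∈ U.powerset.filter (fun W => W ∩ ent = ∅), G' W = Gx W :=
    fun W hW => hIx W (Finset.mem_filter.mp hW).2
  have hG'Iy : ∀ W ∈ U.powerset.filter (fun W => W ∩ ent = ∅), G' W = Gy W :=
    fun W hW => hIy W (Finset.mem_filter.mp hW).2
  have hNIx : N ∅ = ∑ W ∈ U.powerset.filter (fun W => W ∩ ent = ∅), Gx W :=
    Finset.sum_congr rfl fun W hW => hG'Ix W hW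
  have hNIy : N ∅ = ∑ W ∈ U.powerset.filter (fun W => W ∩ ent = ∅), Gy W :=
    Finset.sum_congr rfl fun W hW => hG'Iy W hW
  have hNxI : Nx ∅ = ∑ W ∈ U.powerset.filter (fun W => W ∩ ent = ∅), Gx W * x W :=
    Finset.sum_congr rfl fun W hW => by rw [hG'Ix W hW]
  have hNyI : Ny ∅ = ∑ W ∈ U.powerset.filter (fun W => W ∩ ent = ∅), Gy W * y W :=
    Finset.sum_congr rfl fun W hW => by rw [hG'Iy W hW]
  have hu₀ : Λx * (Nx ∅ / N ∅) - Λx₁ ≤ 0 := by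
    by_cases h : N ∅ = 0
    · rw [h, div_zero, mul_zero]
      have : 0 ≤ Λx₁ := by
        rw [hΛx₁]; exact Finset.sum_nonneg fun W _ => mul_nonneg (hGx W) (hx0 W)
      linarith
    · have hpos : 0 < N ∅ := lt_of_le_of_ne (hN0 ∅) (Ne.symm h)
      have key : Nx ∅ * Λx ≤ N ∅ * Λx₁ := by
        rw [hNxI, hNIx, hΛx, hΛx₁]; exact ideal_mean U ent Gx x hGx hx0 hxm wLLx
      have : Λx * (Nx ∅ / N ∅) ≤ Λx₁ := by
        rw [mul_div_assoc', div_le_iff₀ hpos]; linarith [key]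
      linarith
  have hw₀ : Λy * (Ny ∅ / N ∅) - Λy₂ ≤ 0 := by
    by_cases h : N ∅ = 0
    · rw [h, div_zero, mul_zero]
      have : 0 ≤ Λy₂ := by
        rw [hΛy₂]; exact Finset.sum_nonneg fun W _ => mul_nonneg (hGy W) (hy0 W)
      linarith
    · have hpos : 0 < N ∅ := lt_of_le_of_ne (hN0 ∅) (Ne.symm h)
      have key : Ny ∅ * Λy ≤ N ∅ * Λy₂ := by
        rw [hNyI, hNIy, hΛy, hΛy₂]; exact ideal_mean U ent Gy y hGy hy0 hym wLLy
      have : Λy * (Ny ∅ / N ∅) ≤ Λy₂ := by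
        rw [mul_div_assoc', div_le_iff₀ hpos]; linarith [key]
      linarith
  -- every state mean on the support is above the ideal state mean
  have hu : ∀ W ∈ U.powerset, G' W ≠ 0 → Λx * (Nx ∅ / N ∅) - Λx₁ ≤ Λx * Xb W - Λx₁ := by
    intro W hW hW0
    have hWU : W ⊆ U := Finset.mem_powerset.mp hW
    have hle : Nx ∅ / N ∅ ≤ Xb W := by
      by_cases h : N ∅ = 0
      · rw [h, div_zero]; exact hXb0 W
      · have hpos : 0 < N ∅ := lt_of_le_of_ne (hN0 ∅) (Ne.symm h)
        have hNW := hNpos W hWU hW0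
        have key : Nx ∅ * N (W ∩ ent) ≤ N ∅ * Nx (W ∩ ent) :=
          fiber_holley U ent ∅ (W ∩ ent) G' x hG' hx0 hxm wMM (Finset.empty_subset _)
        show Nx ∅ / N ∅ ≤ Nx (W ∩ ent) / N (W ∩ ent)
        rw [div_le_div_iff₀ hpos hNW]
        linarith [key]
    have := mul_le_mul_of_nonneg_left hle hΛx0
    linarith
  have hw : ∀ W ∈ U.powerset, G' W ≠ 0 → Λy * (Ny ∅ / N ∅) - Λy₂ ≤ Λy * Yb W - Λy₂ := by
    intro W hW hW0
    have hWU : W ⊆ U := Finset.mem_powerset.mp hW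
    have hle : Ny ∅ / N ∅ ≤ Yb W := by
      by_cases h : N ∅ = 0
      · rw [h, div_zero]; exact hYb0 W
      · have hpos : 0 < N ∅ := lt_of_le_of_ne (hN0 ∅) (Ne.symm h)
        have hNW := hNpos W hWU hW0
        have key : Ny ∅ * N (W ∩ ent) ≤ N ∅ * Ny (W ∩ ent) :=
          fiber_holley U ent ∅ (W ∩ ent) G' y hG' hy0 hym wMM (Finset.empty_subset _)
        show Ny ∅ / N ∅ ≤ Ny (W ∩ ent) / N (W ∩ ent)
        rw [div_le_div_iff₀ hpos hNW]
        linarith [key]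
    have := mul_le_mul_of_nonneg_left hle hΛy0
    linarith
  -- the level sets of the `y`-shift: the gate there is Holley-above the `x`-law `Gx`
  have hlevw : ∀ t, Λy * (Ny ∅ / N ∅) - Λy₂ < t →
      0 ≤ ∑ W ∈ U.powerset.filter (fun W => t ≤ Λy * Yb W - Λy₂), G' W * (Λx * Xb W - Λx₁) := by
    intro t ht
    have hP : ∀ s ⊆ U, ∀ t' ⊆ U, t ≤ Λy * Yb s - Λy₂ → G' s ≠ 0 → Gx t' ≠ 0 →
        t ≤ Λy * Yb (s ∪ t') - Λy₂ ∧ (∃ r ∈ ent, r ∈ s) := by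
      intro s hs t' ht' hPs hs0 ht'0
      have hent : ∃ r ∈ ent, r ∈ s := by
        by_contra hno
        have hse : s ∩ ent = ∅ := by
          rw [Finset.eq_empty_iff_forall_notMem]
          intro r hr
          rw [Finset.mem_inter] at hr
          exact hno ⟨r, hr.2, hr.1⟩
        have hYs : Yb s = Ny ∅ / N ∅ := by
          show Ny (s ∩ ent) / N (s ∩ ent) = Ny ∅ / N ∅
          rw [hse]
        rw [hYs] at hPs
        linarith
      refine ⟨?_, hent⟩
      have hu0 := hjoinx s hs t' ht' hent hs0 ht'0
      have hmono := hYb_mono s hs t' ht' hs0 hu0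
      have := mul_le_mul_of_nonneg_left hmono hΛy0
      linarith
    have key := level_holley U ent Gx G' x hGx hG' hx0 hxm wMLx
      (fun W => t ≤ Λy * Yb W - Λy₂) hP
    rw [← hΛx, ← hΛx₁] at key
    have hmean : (∑ W ∈ U.powerset.filter (fun W => t ≤ Λy * Yb W - Λy₂), G' W * Xb W) =
        ∑ W ∈ U.powerset.filter (fun W => t ≤ Λy * Yb W - Λy₂), G' W * x W :=
      sum_fiber_mean U ent G' x hG' (fun e => t ≤ Λy * (Ny e / N e) - Λy₂)
    have hexp : (∑ W ∈ U.powerset.filter (fun W => t ≤ Λy * Yb W - Λy₂),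
          G' W * (Λx * Xb W - Λx₁)) =
        Λx * (∑ W ∈ U.powerset.filter (fun W => t ≤ Λy * Yb W - Λy₂), G' W * Xb W) -
          Λx₁ * (∑ W ∈ U.powerset.filter (fun W => t ≤ Λy * Yb W - Λy₂), G' W) := by
      rw [Finset.mul_sum, Finset.mul_sum, ← Finset.sum_sub_distrib]
      exact Finset.sum_congr rfl fun W _ => by ring
    rw [hexp, hmean]
    linarith [key]
  -- the level sets of the `x`-shift: the gate there is Holley-above the `y`-law `Gy`
  have hlevu : ∀ t, Λx * (Nx ∅ / N ∅) - Λx₁ < t →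
      0 ≤ ∑ W ∈ U.powerset.filter (fun W => t ≤ Λx * Xb W - Λx₁), G' W * (Λy * Yb W - Λy₂) := by
    intro t ht
    have hP : ∀ s ⊆ U, ∀ t' ⊆ U, t ≤ Λx * Xb s - Λx₁ → G' s ≠ 0 → Gy t' ≠ 0 →
        t ≤ Λx * Xb (s ∪ t') - Λx₁ ∧ (∃ r ∈ ent, r ∈ s) := by
      intro s hs t' ht' hPs hs0 ht'0
      have hent : ∃ r ∈ ent, r ∈ s := by
        by_contra hno
        have hse : s ∩ ent = ∅ := by
          rw [Finset.eq_empty_iff_forall_notMem]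
          intro r hr
          rw [Finset.mem_inter] at hr
          exact hno ⟨r, hr.2, hr.1⟩
        have hXs : Xb s = Nx ∅ / N ∅ := by
          show Nx (s ∩ ent) / N (s ∩ ent) = Nx ∅ / N ∅
          rw [hse]
        rw [hXs] at hPs
        linarith
      refine ⟨?_, hent⟩
      have hu0 := hjoiny s hs t' ht' hent hs0 ht'0
      have hmono := hXb_mono s hs t' ht' hs0 hu0
      have := mul_le_mul_of_nonneg_left hmono hΛx0
      linarith
    have key := level_holley U ent Gy G' y hGy hG' hy0 hym wMLy
      (fun W => t ≤ Λx * Xb W - Λx₁) hP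
    rw [← hΛy, ← hΛy₂] at key
    have hmean : (∑ W ∈ U.powerset.filter (fun W => t ≤ Λx * Xb W - Λx₁), G' W * Yb W) =
        ∑ W ∈ U.powerset.filter (fun W => t ≤ Λx * Xb W - Λx₁), G' W * y W :=
      sum_fiber_mean U ent G' y hG' (fun e => t ≤ Λx * (Nx e / N e) - Λx₁)
    have hexp : (∑ W ∈ U.powerset.filter (fun W => t ≤ Λx * Xb W - Λx₁),
          G' W * (Λy * Yb W - Λy₂)) =
        Λy * (∑ W ∈ U.powerset.filter (fun W => t ≤ Λx * Xb W - Λx₁), G' W * Yb W) -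
          Λy₂ * (∑ W ∈ U.powerset.filter (fun W => t ≤ Λx * Xb W - Λx₁), G' W) := by
      rw [Finset.mul_sum, Finset.mul_sum, ← Finset.sum_sub_distrib]
      exact Finset.sum_congr rfl fun W _ => by ring
    rw [hexp, hmean]
    linarith [key]
  -- FKG for the gate with the increasing state means
  have hF : (∑ W ∈ U.powerset, G' W * Xb W) * (∑ W ∈ U.powerset, G' W * Yb W) ≤
      (∑ W ∈ U.powerset, G' W) * (∑ W ∈ U.powerset, G' W * (Xb W * Yb W)) := by
    have n₁ : ∀ W, 0 ≤ G' W * Xb W := fun W => mul_nonneg (hG' W) (hXb0 W)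
    have n₂ : ∀ W, 0 ≤ G' W * Yb W := fun W => mul_nonneg (hG' W) (hYb0 W)
    have n₃ : ∀ W, 0 ≤ G' W := hG'
    have n₄ : ∀ W, 0 ≤ G' W * (Xb W * Yb W) :=
      fun W => mul_nonneg (hG' W) (mul_nonneg (hXb0 W) (hYb0 W))
    refine ad_pointwise U _ _ _ _ n₁ n₂ n₃ n₄ ?_
    intro s hs t ht
    by_cases hs0 : G' s = 0
    · rw [hs0, zero_mul, zero_mul]; exact mul_nonneg (n₃ _) (n₄ _)
    · by_cases ht0 : G' t = 0
      · rw [ht0, zero_mul, mul_zero]; exact mul_nonneg (n₃ _) (n₄ _)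
      · have hu0 := hjoin s hs t ht hs0 ht0
        have hxs := hXb_mono s hs t ht hs0 hu0
        have hu0' : G' (t ∪ s) ≠ 0 := by rw [Finset.union_comm]; exact hu0
        have hyt : Yb t ≤ Yb (s ∪ t) := by
          rw [Finset.union_comm]; exact hYb_mono t ht s hs ht0 hu0'
        calc G' s * Xb s * (G' t * Yb t) = (G' s * G' t) * (Xb s * Yb t) := by ring
          _ ≤ (G' (s ∩ t) * G' (s ∪ t)) * (Xb (s ∪ t) * Yb (s ∪ t)) :=
              mul_le_mul (wMM s hs t ht) (mul_le_mul hxs hyt (hYb0 t) (hXb0 _))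
                (mul_nonneg (hXb0 s) (hYb0 t)) (mul_nonneg (hG' _) (hG' _))
          _ = G' (s ∩ t) * (G' (s ∪ t) * (Xb (s ∪ t) * Yb (s ∪ t))) := by ring
  have e1 : (∑ W ∈ U.powerset, G' W * (Λx * Xb W - Λx₁)) =
      Λx * (∑ W ∈ U.powerset, G' W * Xb W) - Λx₁ * (∑ W ∈ U.powerset, G' W) := by
    rw [Finset.mul_sum, Finset.mul_sum, ← Finset.sum_sub_distrib]
    exact Finset.sum_congr rfl fun W _ => by ring
  have e2 : (∑ W ∈ U.powerset, G' W * (Λy * Yb W - Λy₂)) =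
      Λy * (∑ W ∈ U.powerset, G' W * Yb W) - Λy₂ * (∑ W ∈ U.powerset, G' W) := by
    rw [Finset.mul_sum, Finset.mul_sum, ← Finset.sum_sub_distrib]
    exact Finset.sum_congr rfl fun W _ => by ring
  have e3 : (∑ W ∈ U.powerset, G' W * (Λx * Xb W - Λx₁) * (Λy * Yb W - Λy₂)) =
      Λx * Λy * (∑ W ∈ U.powerset, G' W * (Xb W * Yb W))
        - Λx * Λy₂ * (∑ W ∈ U.powerset, G' W * Xb W)
        - Λy * Λx₁ * (∑ W ∈ U.powerset, G' W * Yb W)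
        + Λx₁ * Λy₂ * (∑ W ∈ U.powerset, G' W) := by
    rw [Finset.mul_sum, Finset.mul_sum, Finset.mul_sum, Finset.mul_sum,
      ← Finset.sum_sub_distrib, ← Finset.sum_sub_distrib, ← Finset.sum_add_distrib]
    exact Finset.sum_congr rfl fun W _ => by ring
  have hfkg : (∑ W ∈ U.powerset, G' W * (Λx * Xb W - Λx₁)) *
      (∑ W ∈ U.powerset, G' W * (Λy * Yb W - Λy₂)) ≤
      (∑ W ∈ U.powerset, G' W) *
        ∑ W ∈ U.powerset, G' W * (Λx * Xb W - Λx₁) * (Λy * Yb W - Λy₂) := by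
    rw [e1, e2, e3]
    have key := mul_le_mul_of_nonneg_left hF (mul_nonneg hΛx0 hΛy0)
    linarith [key]
  -- the clean state lemma
  have hT2 : 0 ≤ ∑ W ∈ U.powerset, G' W * (Λx * Xb W - Λx₁) * (Λy * Yb W - Λy₂) :=
    csl_main U.powerset G' (fun W => Λx * Xb W - Λx₁) (fun W => Λy * Yb W - Λy₂)
      (fun W _ => hG' W) (Λx * (Nx ∅ / N ∅) - Λx₁) (Λy * (Ny ∅ / N ∅) - Λy₂) hu₀ hw₀ hu hw hfkg
      hlevw hlevu
  -- within-state FKG and the fibre identities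
  have hprod : (∑ W ∈ U.powerset, G' W * (Xb W * Yb W)) ≤
      ∑ W ∈ U.powerset, G' W * (x W * y W) :=
    sum_fiber_prod_le U ent G' x y hG' hx0 hy0 hxm hym wMM
  have hmx : (∑ W ∈ U.powerset, G' W * Xb W) = ∑ W ∈ U.powerset, G' W * x W :=
    sum_mean_eq U ent G' x hG'
  have hmy : (∑ W ∈ U.powerset, G' W * Yb W) = ∑ W ∈ U.powerset, G' W * y W :=
    sum_mean_eq U ent G' y hG'
  rw [e3, hmx, hmy] at hT2
  have hprod' := mul_le_mul_of_nonneg_left hprod (mul_nonneg hΛx0 hΛy0)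
  linarith [hT2, hprod']

end MixedAbstract


end Summit.Ventures.PercRepro2.Coin
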